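import Summits.MatrixMultiplication.OmegaCensus.SimplifiableSUSPOmegaBound
import HarnessLib

/-!
# ω-census, family (b′) STPP / USP: Anderson–Le's two separating examples, in the kernel
(local ⊊ simplifiable ⊊ strong USP)

HONEST FRAMING (pub-omega census; verbatim): lottery ticket; floor = certified bounds/negative ranges.
Census BOOKKEEPING (non-vacuity witnesses for the tree's `IsSimplifiable`), not progress on `ω`.

Anderson–Le 2023 (arXiv:2307.06463), §3.3, AS PRINTED: "Intuitively, simplifiable SUSPs are an intermediate class between
local SUSPs and SUSPs. The sets containments are proper. There exist SUSPs that are not simplifiable and simplifiable SUSPs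
that are not local. For example, `P₁ = {2233, 1232, 1123, 3311}` is an SUSP, but it is not a simplifiable SUSP, and
`P₂ = {11, 23}` is a simplifiable SUSP, but it is not a local SUSP."  (§4.2 adds: "`P = {2233, 1232, 1123, 3311}` is an SUSP, but
`P × P` is not.")

* `isStrongUSP_AndersonLe_P1` — `P₁` is a strong USP (`(4!)²` permutation pairs, `decide`).
* `not_isSimplifiable_AndersonLe_P1` — `P₁` is NOT simplifiable (fixed-point form `IsSimplifiable` of the tree; a fortiori not in the
  sense of Def. 5, by `IsSimplifiableSUSP.isSimplifiable`): its silent 3D graph `H_{P₁}` (23 triples) is itself supported —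
  each of the three faces is strongly connected (a 4-cycle through all four rows) — and contains the off-diagonal triple
  `(2233, 2233, 1232)`; i.e. the complete simplification of `H_{P₁}` deletes nothing.
* `not_isLocalStrongUSP_AndersonLe_P2` — `P₂ = {11, 23}` is not a local strong USP (the ordered triple `(11, 11, 23)` hits no
  admissible pattern); it IS simplifiable: the tree's `isSimplifiable_AndersonLe_2_2` (`SimplifiableSUSPInstancesAL.lean`; the same
  literal — Appendix A's (2,2) puzzle is `P₂`).

References: M. Anderson, V. Le, arXiv:2307.06463, §3.3 (examples after Lemma 7), §4.2 [AndersonLe2023].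
-/

namespace Summit.MatrixMultiplication.OmegaCensus

open Literature.Computability.AlgebraicComplexity Relation

/-- **AL §3.3: `P₁ = {2233, 1232, 1123, 3311}` is a strong USP** (symbols coded `0,1,2`; `(4!)²` permutation pairs after
`isStrongUSP_iff_fix_first`, by `decide`). [cite: AndersonLe2023, §3.3 (example P₁)] -/
theorem isStrongUSP_AndersonLe_P1 : IsStrongUSP ![![1, 1, 2, 2], ![0, 1, 2, 1], ![0, 0, 1, 2], ![2, 2, 0, 0]] := by
  rw [isStrongUSP_iff_fix_first]
  decide +kernel

/-- A digraph on `Fin 4` with a 4-cycle through all vertices is strongly connected. [folklore] -/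
private theorem reflTransGen_all_of_cycle4 {R : Fin 4 → Fin 4 → Prop} {a b c d : Fin 4}
    (hab : R a b) (hbc : R b c) (hcd : R c d) (hda : R d a) (hcover : ∀ x : Fin 4, x = a ∨ x = b ∨ x = c ∨ x = d) :
    ∀ x y : Fin 4, ReflTransGen R x y := by
  have ha : ∀ y, ReflTransGen R a y := by
    intro y
    rcases hcover y with rfl | rfl | rfl | rfl
    · exact ReflTransGen.refl
    · exact ReflTransGen.single hab
    · exact (ReflTransGen.single hab).tail hbc
    · exact ((ReflTransGen.single hab).tail hbc).tail hcd
  have hb : ∀ x, ReflTransGen R x a := by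
    intro x
    rcases hcover x with rfl | rfl | rfl | rfl
    · exact ReflTransGen.refl
    · exact ((ReflTransGen.single hbc).tail hcd).tail hda
    · exact (ReflTransGen.single hcd).tail hda
    · exact ReflTransGen.single hda
  exact fun x y => (hb x).trans (ha y)

/-- **AL §3.3: `P₁ = {2233, 1232, 1123, 3311}` is NOT simplifiable** — its silent 3D graph `H_{P₁}` is supported (all three faces
strongly connected via the 4-cycles `1→4→2→3→1` in `R₂`, `R₁` and `1→2→3→4→1` in `R₀`, rows numbered as printed) and contains the
off-diagonal triple `(1,1,2)`: the complete simplification removes no edge (AL: "no edges are removed from any of the three 2D faces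
causing the algorithm to immediately reach a fixed point"), so `H_{P₁}` does not simplify to the trivial matching.
[cite: AndersonLe2023, §3.3 (example P₁)] -/
theorem not_isSimplifiable_AndersonLe_P1 :
    ¬ IsSimplifiable ![![1, 1, 2, 2], ![0, 1, 2, 1], ![0, 0, 1, 2], ![2, 2, 0, 0]] := by
  intro h
  have hcov : ∀ x : Fin 4, x = 0 ∨ x = 3 ∨ x = 1 ∨ x = 2 := by decide
  have hcov' : ∀ x : Fin 4, x = 0 ∨ x = 1 ∨ x = 2 ∨ x = 3 := by decide
  have hS : USPSupported (USPSilent ![![1, 1, 2, 2], ![0, 1, 2, 1], ![0, 0, 1, 2], ![2, 2, 0, 0]]) := by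
    intro a b c _
    refine ⟨?_, ?_, ?_⟩
    · refine reflTransGen_all_of_cycle4 (a := 0) (b := 3) (c := 1) (d := 2) ?_ ?_ ?_ ?_ hcov _ _ <;>
        rw [uspFace_two_iff] <;> unfold USPSilent
      · exact ⟨0, by decide⟩
      · exact ⟨2, by decide⟩
      · exact ⟨2, by decide⟩
      · exact ⟨3, by decide⟩
    · refine reflTransGen_all_of_cycle4 (a := 0) (b := 3) (c := 1) (d := 2) ?_ ?_ ?_ ?_ hcov _ _ <;>
        rw [uspFace_one_iff] <;> unfold USPSilent
      · exact ⟨2, by decide⟩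
      · exact ⟨2, by decide⟩
      · exact ⟨3, by decide⟩
      · exact ⟨3, by decide⟩
    · refine reflTransGen_all_of_cycle4 (a := 0) (b := 1) (c := 2) (d := 3) ?_ ?_ ?_ ?_ hcov' _ _ <;>
        rw [uspFace_zero_iff] <;> unfold USPSilent
      · exact ⟨0, by decide⟩
      · exact ⟨3, by decide⟩
      · exact ⟨0, by decide⟩
      · exact ⟨0, by decide⟩
  have h001 : USPSilent ![![1, 1, 2, 2], ![0, 1, 2, 1], ![0, 0, 1, 2], ![2, 2, 0, 0]] 0 0 1 := by
    unfold USPSilent; decide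
  have := (h _ (fun _ _ _ hx => hx) hS 0 0 1 h001).2
  exact absurd this (by decide)

/-- **AL §3.3: `P₂ = {11, 23}` is not a local strong USP** (the ordered triple `(11, 11, 23)` of rows has no admissible
coordinate); it is simplifiable — the tree's `isSimplifiable_AndersonLe_2_2` is this very puzzle (Appendix A's (2,2) entry).
[cite: AndersonLe2023, §3.3 (example P₂)] -/
theorem not_isLocalStrongUSP_AndersonLe_P2 : ¬ IsLocalStrongUSP ![![0, 0], ![1, 2]] := by
  unfold IsLocalStrongUSP localStrongUSPPatterns
  decide

/-- The strict chain local ⊊ simplifiable ⊊ strong USP is witnessed in the kernel: `P₂` is simplifiable (2-block closed-set certificate, as in the tree's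
`isSimplifiable_AndersonLe_2_2`) but not local, `P₁` is a strong USP but not simplifiable. [cite: AndersonLe2023, §3.3] -/
theorem simplifiable_strictly_between_local_and_strong :
    (IsSimplifiable ![![0, 0], ![1, 2]] ∧ ¬ IsLocalStrongUSP ![![0, 0], ![1, 2]]) ∧
      (IsStrongUSP ![![1, 1, 2, 2], ![0, 1, 2, 1], ![0, 0, 1, 2], ![2, 2, 0, 0]] ∧
        ¬ IsSimplifiable ![![1, 1, 2, 2], ![0, 1, 2, 1], ![0, 0, 1, 2], ![2, 2, 0, 0]]) :=
  ⟨⟨isSimplifiable_of_suspMaskCheck (cert := [(0, 1), (1, 1)]) (by decide +kernel), not_isLocalStrongUSP_AndersonLe_P2⟩,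
    ⟨isStrongUSP_AndersonLe_P1, not_isSimplifiable_AndersonLe_P1⟩⟩

end Summit.MatrixMultiplication.OmegaCensus
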